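import Summits.BirchSwinnertonDyer.BirchSwinnertonDyer.Theorems.AdditiveKolyvaginRoadBottomRankOneAdditiveTight
import Summits.BirchSwinnertonDyer.Rank1Residual.X11b.Three.KolyvaginNonvanishing
import Literature.NumberTheory.EllipticCurves.KolyvaginShaStructureCertificate
import Literature.NumberTheory.EllipticCurves.BSDSelmerPConverseSerreProofs
import HarnessLib

/-!
# Route `AdditiveKolyvaginRoad`, crux `BottomRankOneAdditive` (item stmt-BirchSwinnertonDyer-21397):
# THE BOTTOM CRUX IS A COROLLARY OF THE PARENT CRUX —
# `BottomRankOneAdditive ⟸ PublishedInputsAdditiveKoly ∧ KolyvaginPrimitiveAdditive`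
# (cell `pub/bsd-wall`, width seat `bsd-wall-akr-p3-w3` g0; `--supports stmt-BirchSwinnertonDyer-21397`, helper)

THEOREMS ONLY (no definition, no named fact, no `sorry`); nothing about Kolyvagin's conjecture is asserted — the
conclusion of the parent crux `KolyvaginPrimitiveAdditive` («some mod-`p` Kolyvagin class `c(n) ≠ 0`») and every
published input below are HYPOTHESES. BSD is not proved by any of this.

THE POINT. The parent crux r2 `KolyvaginPrimitiveAdditive` (KPA′, item 21400) concludes, at every ♯ additive frame,
`∃ n d, KolSupp n ∧ c_d(n) ≢ 0 (mod p)` — Kolyvagin's conjecture mod `p`, with an UNPINNED Kolyvagin conductor `n`.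
The bottom crux r10 `BottomRankOneAdditive` (BOT′, this item) asks, at the frames with `#Sel_p(E/K) = p`, for the
PINNED witness `n = 1`: `c(1) = δ y_K ≢ 0`. In the parent skeleton v9 (`Cruxes/KolyvaginPrimitiveAdditive/Lines/
birth.lean`) BOT′ serves the case `s = 1` of KPA′; the two-prime bottom of akr-p2x (`…LevelSystemsBottom`, p567709)
and the BOT′-free glue `PUB → DUAL → KS′ → KPA′` (akr-p1 g5 ∕ akr-p2x) remove that need — but they conclude `∃ n`,
not `n = 1`. This file supplies the converse bookkeeping, in BOT′'s own currency:

  **at a frame with `#Sel_p(E/K) = p`, ANY non-zero mod-`p` Kolyvagin class forces `c(1) ≠ 0`**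

— Kolyvagin's «`ν = max(r⁺, r⁻) − 1`» at total `p`-Selmer rank one, obtained cheaply from McCallum's Cor. 5.6 in
its CERTIFICATE half (tree named fact `McCallum1991_pow_dvd_card_sha_primary_of_certificate`, the 9th conjunct of
the route's `PublishedInputsAdditiveKoly`): a derived Heegner point `P_n` NOT divisible by `p` in `E(K[n])` at a
Kolyvagin level `n` (all `M(ℓ) ≥ 1`) is a certificate `M_r ≤ 0`, whence `p^{2·M₀} ∣ #Ш(E/K)[p^∞]`, where `p^{M₀} ∥ y_K`
in `E(K)` (`y_K` non-torsion by Gross–Zagier since `ord_{s=1} L(E/K,s) = 1`; exact exponent exists because `E(K)` is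
finitely generated). But `#Sel_p(E/K) = p` with `rank E(K) = 1` (Kolyvagin) and `E(K)[p] = 0` (`ρ̄_{E,p}` irreducible)
forces `Ш(E/K)[p^∞] = 0`; so `M₀ = 0`, i.e. `y_K ∉ p·E(K)`, i.e. `P(1) ∉ p·E(K[1])` for every conductor-`1` datum
(McCallum Lemma 5.1 with Gross Lemma 4.3, Shimura reciprocity at conductor `1` — all PROVED in the tree), i.e. (glue
stub `stub_kolyvaginClassOneOfNotPDiv`, p567354) some conductor-`1` datum has `c(1) ≠ 0`. The fact's `p`-adic tower
surjectivity comes from `ρ̄_{E,p}` onto by Serre's `p ≥ 5` lifting (tree theorem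
`serre_hasSurjectiveModNGaloisRep_pow_holds`); its `¬CM` from a multiplicative prime ♠(2); `d_K ∉ {−3, −4}` from
`d_K < −4`. No additive hypothesis at `p` is used at frame level (§1 holds at any `p ≥ 5` with `ρ̄` onto).

* §1 `heegnerPoint_not_pDiv_of_exists_kolyvaginClass_ne_zero` — ONE frame, point currency: KPA′'s conclusion at the
  frame + `#Sel_p(E/K) = p` ⟹ `∀ d₁, ¬ Koly.PDiv d₁ p 1` (the conclusion of the open stubs of skeleton v3 of BOT′).
* §2 `exists_kolyvaginClass_one_ne_zero_of_exists_kolyvaginClass_ne_zero` — class currency (BOT′'s conclusion at the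
  frame); `exists_kolyvaginClass_ne_zero_iff_exists_kolyvaginClass_one_ne_zero` — at such a frame KPA′'s and BOT′'s
  conclusions are EQUIVALENT (`⇐`: `n = 1` is a Kolyvagin level, `kolSupp_one`).
* §3 `bottomRankOneAdditive_of_kolyvaginPrimitiveAdditive` — CLASS LEVEL, against the route's decls:
  `PublishedInputsAdditiveKoly → KolyvaginPrimitiveAdditive → BottomRankOneAdditive` (only Gross–Zagier, Kolyvagin,
  modularity and McCallum's certificate half are used). Consequences for the planner (recorded, not acted on):
  (i) the stub BOT of skeleton v9 was NECESSARY — KPA′ implies it modulo PUB, so cutting KPA′ as P ∧ KS′ ∧ BOT′ ∧ LOC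
  lost nothing at the bottom; (ii) crux r10 closes by a one-line corollary the moment crux r2 does; (iii) with the
  BOT′-free glue `PUB → DUAL → KS′ → KPA′` (§4 displays it as a binder) the desk's sentence «BOT′ is a corollary of
  KS′ + DUAL» becomes kernel-true in BOT′'s own currency: `PUB → DUAL → KS′ → BOT′`.
* §4 `bottomRankOneAdditive_of_levelSystems_of_botFreeGlue` — (iii), with the glue as an explicit hypothesis.

References (locators only): [cite: McCallumLMS1991, §5 Lemma 5.1 and Cor. 5.6 (p. 310); §4 Cor. 4.5]
[cite: KolyvaginEulerSystems1990, Thm. 3 (structure of the Selmer group from a non-zero class)]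
[cite: GrossLMS1991, (1.1), Thm. 1.3, Lemma 4.3, §4 (P_1 = y_K)] [cite: WZhang2014, Thm. 1.1 and §9 (ν = r − 1)]
[cite: SerreAbelianLadic1968, IV-23 Lemma 3] [cite: Darmon2004, Thm. 3.6–3.7].
-/

-- single-conjunct summit: `Summit.BirchSwinnertonDyer.BirchSwinnertonDyer.…` repeats the name by design
set_option linter.dupNamespace false

set_option autoImplicit false

noncomputable section

open scoped Classical

namespace Summit.BirchSwinnertonDyer.BirchSwinnertonDyer.Theorems.AdditiveKoly

open WeierstrassCurve NumberField Field
  Literature.NumberTheory.EllipticCurves Literature.NumberTheory.EllipticCurves.ModularForms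
  Literature.NumberTheory.EllipticCurves.Rank1Residual
  Summit.BirchSwinnertonDyer.Rank1Residual Summit.BirchSwinnertonDyer.Rank1Residual.X11b
  Summit.BirchSwinnertonDyer.Rank1Residual.X11b.Three
  Summit.BirchSwinnertonDyer.BirchSwinnertonDyer.Theses.AdditiveKolyvaginRoad

/-! ## §1 One frame: a non-zero mod-`p` Kolyvagin class at ANY level forces `y_K ∉ p·E(K[1])` -/

section Frame

variable (W : WeierstrassCurve ℚ) [W.IsElliptic] [W.IsGloballyMinimal] [NeZero (W.conductorNorm ℤ)]
  (p : ℕ) [hp : Fact p.Prime] (K : Type) [Field K] [NumberField K]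
  (Dt : ModularParametrizationData W (W.conductorNorm ℤ)) (β : ℤ) (ι : K →+* ℂ)

/-- **KOLYVAGIN'S CONJECTURE MOD `p` PINS ITS OWN WITNESS AT `n = 1` IN `p`-SELMER RANK ONE (point currency).** Data:
`W/ℚ` globally minimal elliptic, non-CM, `p ≥ 5` with `ρ̄_{E,p}` onto, `ord_{s=1} L(E,s) = 1`; `K` imaginary quadratic
with `d_K < −4`, the Heegner hypothesis for `N_E` and `L(E^{(d_K)},1) ≠ 0`; a frame `(Dt, β, ι)` with
`4N_E ∣ β² − d_K`; and `#Sel_p(E/K) = p`. PUBLISHED inputs as binders: Gross–Zagier `hGZ`, Kolyvagin `hKo`,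
modularity `hmod`, McCallum's Cor. 5.6 certificate half `hMc`. HYPOTHESIS `hprim`: some Kolyvagin–Heegner datum `d`
of some Kolyvagin level `n` (square-free product of Zhang–Kolyvagin primes, `n = 1` allowed) has
`c_d(n) = d.kolyvaginClass _ 1 ≠ 0` in `H¹(K, E[p])` — the conclusion of the parent crux `KolyvaginPrimitiveAdditive`
at the frame. CONCLUSION: `P(1) = y_K ∉ p·E(K[1])` for EVERY conductor-`1` datum (`¬ Koly.PDiv d₁ p 1`). Proof:
`c_d(n) ≠ 0` ⇒ `P_n ∉ p·E(K[n])` (McCallum Cor. 4.5, easy half) is a certificate at exponent `0`; McCallum Cor. 5.6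
(certificate half, `hMc`, fed with Serre's tower lifting of `ρ̄` onto) ⇒ `2·M₀ ≤ ord_p #Ш(E/K)[p^∞]` for the exact
`p`-divisibility exponent `M₀` of the Gross–Zagier non-torsion `y_K ∈ E(K)`; `#Sel_p(E/K) = p`, `rank E(K) = 1`
(Kolyvagin), `E(K)[p] = 0` ⇒ `Ш(E/K)[p^∞] = 0` ⇒ `M₀ = 0`; transfer `E(K) ↔ E(K[1])` by McCallum Lemma 5.1 / Gross
Lemma 4.3 / Shimura reciprocity (proved). CONDITIONAL on every binder; nothing is booked.
[cite: McCallumLMS1991, §5 Cor. 5.6 (p. 310), Lemma 5.1; §4 Cor. 4.5] [cite: KolyvaginEulerSystems1990, Thm. 3]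
[cite: GrossLMS1991, (1.1), Thm. 1.3, Lemma 4.3] [cite: SerreAbelianLadic1968, IV-23 Lemma 3] -/
theorem heegnerPoint_not_pDiv_of_exists_kolyvaginClass_ne_zero
    -- published inputs (named facts of the tree)
    (hGZ : gross_zagier (W.conductorNorm ℤ) W K) (hKo : kolyvagin (W.conductorNorm ℤ) W K)
    (hmod : hasEntireLFunction_rat) (hMc : McCallum1991_pow_dvd_card_sha_primary_of_certificate)
    -- the frame (only the binders that are used)
    (hp5 : 5 ≤ p) (hs : W.HasSurjectiveModNGaloisRep p) (hCM : ¬ W.HasCM) (hr : W.analyticRank = 1)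
    (hK : IsImaginaryQuadratic K) (hlt : NumberField.discr K < -4)
    (hH : SatisfiesHeegnerHypothesis (W.conductorNorm ℤ) K)
    (hL : (W.quadraticTwist (NumberField.discr K : ℚ)).entireLFunction 1 ≠ 0)
    (hβ : (4 * (W.conductorNorm ℤ : ℤ)) ∣ β ^ 2 - NumberField.discr K)
    (hSel : Nat.card (WeierstrassCurve.selmerGroup (W.baseChange K) (p : ℤ)) = p)
    -- the hypothesis: a non-zero mod-`p` Kolyvagin class at some Kolyvagin level (KPA′'s conclusion at the frame)
    (hprim : ∃ (n : ℕ) (d : KolyvaginHeegnerData Dt β ι n),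
      KolyvaginDescent.KolSupp (Zhang2014.IsKolyvaginPrime (W.conductorNorm ℤ) W K p) n ∧
        d.kolyvaginClass hp.out 1 ≠ 0) :
    ∀ d₁ : KolyvaginHeegnerData Dt β ι 1, ¬ Koly.PDiv d₁ p 1 := by
  intro d₁
  have hpP : p.Prime := hp.out
  have hp2 : p ≠ 2 := by omega
  have hirr : W.HasIrreducibleModPGaloisRep p :=
    hasIrreducibleModPGaloisRep_of_hasSurjectiveModNGaloisRep W p hs
  -- Serre: `ρ̄_{E,p}` onto at `p ≥ 5` lifts to the whole `p`-adic tower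
  have hsurjT : ∀ m : ℕ, W.HasSurjectiveModNGaloisRep (p ^ m : ℕ) :=
    serre_hasSurjectiveModNGaloisRep_pow_holds W p hp5 hs
  have h3 : NumberField.discr K ≠ -3 := by omega
  have h4 : NumberField.discr K ≠ -4 := by omega
  have hDneg : NumberField.discr K < 0 := by omega
  -- an oriented Heegner datum `H` with `H.β = β` and THE Heegner point `P = y_K ∈ E(K)` (Darmon 3.6, proved)
  obtain ⟨H, hHβ⟩ := exists_heegnerDatum (W.conductorNorm ℤ) hDneg hβ
  obtain ⟨P, hP⟩ := heegnerPointComplex_mem_range_map_holds (W.conductorNorm ℤ) W K hK hH Dt H ι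
  -- arithmetic of `E(K)`: `y_K` non-torsion (Gross–Zagier), rank one and `Ш(E/K)` finite (Kolyvagin), `E(K)[p] = 0`
  have hPinf : ¬ IsOfFinAddOrder P :=
    not_isOfFinAddOrder_of_heegner_of_analyticRank_eq_one W (W.conductorNorm ℤ) K Dt H ι P hGZ hmod hr hK hH hL hP
  obtain ⟨hrank, hSha⟩ := hKo hK hH ⟨Dt, H, ι, hP⟩ hPinf
  haveI : Finite (W.baseChange K).sha := hSha
  have hbot := torsionBy_eq_bot_of_isImaginaryQuadratic_of_hasIrreducibleModPGaloisRep W K hK hpP hirr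
  have ht : Nat.card (AddSubgroup.torsionBy (W.baseChange K).toAffine.Point (p : ℤ)) = 1 := by
    rw [hbot]; exact AddSubgroup.card_bot
  -- `#Sel_p(E/K) = p`, rank one, `E(K)[p] = 0` ⟹ `Ш(E/K)[p^∞] = 0`
  have hShabot : AddCommGroup.primaryComponent (W.baseChange K).sha p = ⊥ :=
    primaryComponent_sha_eq_bot_of_card_selmerGroup_eq (W.baseChange K) p hSel hrank ht
  have hsha0 : padicValNat p (Nat.card (AddCommGroup.primaryComponent (W.baseChange K).sha p)) = 0 := by
    rw [hShabot, AddSubgroup.card_bot, padicValNat_one_right]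
  -- `p^{M₀} ∥ P` in `E(K)` (exact exponent: `P` non-torsion, `E(K)` finitely generated)
  haveI : Module.Finite ℤ (W.baseChange K).toAffine.Point := (W.baseChange K).module_finite_point_holds
  obtain ⟨M₀, x₀, hx₀, hmax⟩ := exists_pow_smul_eq_and_forall_ne hPinf (p := p) hpP.two_le
  have hdiv : ∃ Q : (W.baseChange K).toAffine.Point, ((p ^ M₀ : ℕ) : ℤ) • Q = P :=
    ⟨x₀, by rw [natCast_zsmul]; exact hx₀⟩
  have hndiv : ¬ ∃ Q : (W.baseChange K).toAffine.Point, ((p ^ (M₀ + 1) : ℕ) : ℤ) • Q = P := by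
    rintro ⟨Q, hQ⟩
    exact hmax Q (by rw [← natCast_zsmul]; exact hQ)
  -- the certificate: a non-zero mod-`p` class at a Kolyvagin level `n` is a non-divisible `P_n` (McCallum Cor. 4.5)
  obtain ⟨n, d, hn, hne⟩ := hprim
  have hrec := heegnerPointOfConductor_one_galoisConj_holds (W.conductorNorm ℤ) W K
  -- `P(1) = y_K` in `E(K̄)` (Shimura reciprocity at conductor `1`, proved)
  have hPd : d₁.toGeomPoints d₁.derivedPoint = toGeomPoints (W.baseChange K) P :=
    KolyvaginBottom.toGeomPoints_derivedPoint_one_eq hrec hK hH hP d₁ hHβ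
  have hℓ : ∀ ℓ ∈ n.primeFactors, Zhang2014.IsKolyvaginPrime (W.conductorNorm ℤ) W K p ℓ ∧
      0 + 1 ≤ Zhang2014.kolyvaginIndex W p ℓ :=
    fun ℓ hℓ ↦ ⟨hn.2 ℓ hℓ, (hn.2 ℓ hℓ).2.2.2.2.2⟩
  have hcert : ¬ ∃ Q : (W.baseChange (ringClassField K ι n)).toAffine.Point,
      ((p ^ (0 + 1) : ℕ) : ℤ) • Q = d.derivedPoint :=
    Koly.not_pDiv_of_kolyvaginClass_ne_zero d hne
  -- McCallum Cor. 5.6, certificate half: `2·(M₀ − 0) ≤ ord_p #Ш(E/K)[p^∞] = 0`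
  have hle := two_mul_sub_le_padicValNat_card_sha_primary_of_certificate hMc W hCM K hK h3 h4 hH p hp2 hsurjT
    Dt β ι d₁ P hPd hPinf hdiv hndiv d hn.1 hℓ hcert
  have hM0 : M₀ = 0 := by
    rw [hsha0] at hle
    omega
  -- transfer to `E(K[1])`: `P(1)` is the image of `P` (McCallum Lemma 5.1 with Gross Lemma 4.3)
  obtain ⟨P₀, -, hP₀⟩ := heegnerSystem_exists_isHeegnerPoint_map_eq_derivedPoint_one hrec hK hH d₁
  have hPP : P₀ = P := KolyvaginBottom.eq_of_map_eq_heegnerPointComplex hrec hK hH d₁ hHβ hP hP₀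
  rw [hPP] at hP₀
  rw [pDiv_one_iff_exists_zsmul_eq_of_surj W p K Dt β ι hp2 hs hK d₁ P hP₀ 1]
  rintro ⟨Qx, hQx⟩
  subst hM0
  have h1 := hmax Qx
  rw [zero_add] at h1
  rw [natCast_zsmul] at hQx
  exact h1 hQx

/-! ## §2 The same in the crux's currency, and the equivalence of the two conclusions at the frame -/

/-- **KOLYVAGIN'S CONJECTURE MOD `p` PINS ITS OWN WITNESS AT `n = 1` IN `p`-SELMER RANK ONE (class currency)**: under
the data and binders of `heegnerPoint_not_pDiv_of_exists_kolyvaginClass_ne_zero`, a non-zero mod-`p` Kolyvagin class at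
SOME Kolyvagin level gives a conductor-`1` datum with `c(1) = d.kolyvaginClass _ 1 ≠ 0` — the conclusion of
`Theses.AdditiveKolyvaginRoad.BottomRankOneAdditive` at this frame (glue `stub_kolyvaginClassOneOfNotPDiv`).
CONDITIONAL on every binder; nothing is booked. [cite: McCallumLMS1991, §5 Cor. 5.6, §4 Cor. 4.5]
[cite: KolyvaginEulerSystems1990, Thm. 3] [cite: GrossLMS1991, Lemma 4.3, Prop. 3.6] -/
theorem exists_kolyvaginClass_one_ne_zero_of_exists_kolyvaginClass_ne_zero
    (hGZ : gross_zagier (W.conductorNorm ℤ) W K) (hKo : kolyvagin (W.conductorNorm ℤ) W K)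
    (hmod : hasEntireLFunction_rat) (hMc : McCallum1991_pow_dvd_card_sha_primary_of_certificate)
    (hp5 : 5 ≤ p) (hs : W.HasSurjectiveModNGaloisRep p) (hCM : ¬ W.HasCM) (hr : W.analyticRank = 1)
    (hK : IsImaginaryQuadratic K) (hlt : NumberField.discr K < -4)
    (hH : SatisfiesHeegnerHypothesis (W.conductorNorm ℤ) K)
    (hL : (W.quadraticTwist (NumberField.discr K : ℚ)).entireLFunction 1 ≠ 0)
    (hβ : (4 * (W.conductorNorm ℤ : ℤ)) ∣ β ^ 2 - NumberField.discr K)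
    (hSel : Nat.card (WeierstrassCurve.selmerGroup (W.baseChange K) (p : ℤ)) = p)
    (hprim : ∃ (n : ℕ) (d : KolyvaginHeegnerData Dt β ι n),
      KolyvaginDescent.KolSupp (Zhang2014.IsKolyvaginPrime (W.conductorNorm ℤ) W K p) n ∧
        d.kolyvaginClass hp.out 1 ≠ 0) :
    ∃ d : KolyvaginHeegnerData Dt β ι 1, d.kolyvaginClass hp.out 1 ≠ 0 :=
  stub_kolyvaginClassOneOfNotPDiv W p K Dt β ι hp5 hs hK hlt hH hβ
    (heegnerPoint_not_pDiv_of_exists_kolyvaginClass_ne_zero W p K Dt β ι hGZ hKo hmod hMc hp5 hs hCM hr hK hlt hH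
      hL hβ hSel hprim)

/-- **At a frame with `#Sel_p(E/K) = p`, «some mod-`p` Kolyvagin class is non-zero» ⟺ «some conductor-ONE class
`c(1)` is non-zero»** — the conclusions of the parent crux `KolyvaginPrimitiveAdditive` and of the bottom crux
`BottomRankOneAdditive` AGREE at the bottom frames, granted Gross–Zagier, Kolyvagin, modularity and McCallum's
certificate half (binders). `⇒` is §2; `⇐`: `n = 1` is a Kolyvagin level (`KolyvaginDescent.kolSupp_one`).
A REFORMULATION modulo the binders; nothing is asserted about either side. [cite: McCallumLMS1991, §5 Cor. 5.6]
[cite: KolyvaginEulerSystems1990, Thm. 3] [cite: WZhang2014, Thm. 1.1 and §9] -/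
theorem exists_kolyvaginClass_ne_zero_iff_exists_kolyvaginClass_one_ne_zero
    (hGZ : gross_zagier (W.conductorNorm ℤ) W K) (hKo : kolyvagin (W.conductorNorm ℤ) W K)
    (hmod : hasEntireLFunction_rat) (hMc : McCallum1991_pow_dvd_card_sha_primary_of_certificate)
    (hp5 : 5 ≤ p) (hs : W.HasSurjectiveModNGaloisRep p) (hCM : ¬ W.HasCM) (hr : W.analyticRank = 1)
    (hK : IsImaginaryQuadratic K) (hlt : NumberField.discr K < -4)
    (hH : SatisfiesHeegnerHypothesis (W.conductorNorm ℤ) K)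
    (hL : (W.quadraticTwist (NumberField.discr K : ℚ)).entireLFunction 1 ≠ 0)
    (hβ : (4 * (W.conductorNorm ℤ : ℤ)) ∣ β ^ 2 - NumberField.discr K)
    (hSel : Nat.card (WeierstrassCurve.selmerGroup (W.baseChange K) (p : ℤ)) = p) :
    (∃ (n : ℕ) (d : KolyvaginHeegnerData Dt β ι n),
      KolyvaginDescent.KolSupp (Zhang2014.IsKolyvaginPrime (W.conductorNorm ℤ) W K p) n ∧
        d.kolyvaginClass hp.out 1 ≠ 0) ↔
    ∃ d : KolyvaginHeegnerData Dt β ι 1, d.kolyvaginClass hp.out 1 ≠ 0 := by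
  constructor
  · exact exists_kolyvaginClass_one_ne_zero_of_exists_kolyvaginClass_ne_zero W p K Dt β ι hGZ hKo hmod hMc hp5 hs
      hCM hr hK hlt hH hL hβ hSel
  · rintro ⟨d, hd⟩
    exact ⟨1, d, KolyvaginDescent.kolSupp_one _, hd⟩

end Frame

/-! ## §3 Class level, against the route's decls: `BottomRankOneAdditive ⟸ PublishedInputs ∧ KolyvaginPrimitiveAdditive` -/

/-- **THE BOTTOM CRUX IS A COROLLARY OF THE PARENT CRUX (modulo the published inputs).** Granted the route's
published-inputs conjunction `PublishedInputsAdditiveKoly` (only Gross–Zagier, Kolyvagin, modularity and McCallum's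
Cor. 5.6 certificate half are used), the parent crux `KolyvaginPrimitiveAdditive` (item 21400: at every ♯ additive
frame some mod-`p` Kolyvagin class of Kolyvagin-prime support is non-zero) implies the bottom crux
`BottomRankOneAdditive` (item 21397: at every ♯ additive frame with `#Sel_p(E/K) = p`, `c(1) ≠ 0`): frame by frame
§2, with `¬CM` from a multiplicative prime ♠(2). So crux r10 carries NO surplus over crux r2: the stub BOT of
skeleton v9 was necessary, and r10 closes the moment r2 does. CONDITIONAL on both antecedents; nothing is booked.
[cite: McCallumLMS1991, §5 Cor. 5.6 (p. 310)] [cite: KolyvaginEulerSystems1990, Thm. 3] [cite: WZhang2014, Thm. 1.1, §9] -/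
theorem bottomRankOneAdditive_of_kolyvaginPrimitiveAdditive
    (hPub : PublishedInputsAdditiveKoly) (hKPA : KolyvaginPrimitiveAdditive) :
    BottomRankOneAdditive := by
  intro W _ _ _ p _ K _ _ Dt β ι hp5 hadd hs hsp htwo htam hr hK hodd hlt hH hL hβ hc hSel
  obtain ⟨hGZ, hKo, -, -, hmod, -, -, -, hMc, -⟩ := hPub
  -- non-CM from a multiplicative prime
  obtain ⟨ℓ₁, ℓ₂, hℓ₁, hℓ₂, hne, hm₁, hm₂⟩ := htwo
  have hCM : ¬ W.HasCM := not_hasCM_of_hasMultiplicativeReductionAtPrime' W hm₁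
  -- the parent crux at this frame: some mod-`p` Kolyvagin class is non-zero
  have hprim := hKPA W p K Dt β ι hp5 hadd hs hsp ⟨ℓ₁, ℓ₂, hℓ₁, hℓ₂, hne, hm₁, hm₂⟩ htam hr hK hodd hlt hH hL hβ hc
  exact exists_kolyvaginClass_one_ne_zero_of_exists_kolyvaginClass_ne_zero W p K Dt β ι (hGZ _ W K) (hKo _ W K)
    hmod hMc hp5 hs hCM hr hK hlt hH hL hβ hSel hprim

/-! ## §4 With the BOT′-free glue displayed: `PUB → DUAL → KS′ → BOT′` -/

/-- **`BottomRankOneAdditive` inside the cone of `LevelKolyvaginSystemsAdditive`**, granted the BOT′-free glue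
`PublishedInputsAdditiveKoly → PublishedDualityInputsAdditiveKoly → LevelKolyvaginSystemsAdditive →
KolyvaginPrimitiveAdditive` (the theorem `kolyvaginPrimitiveAdditive_of_published_of_levelSystems` of akr-p1 ∕
akr-p2x, here an explicit HYPOTHESIS `hglue` so that this file does not depend on its landing): published inputs,
duality inputs and the level systems KS′ imply the bottom crux BOT′ — §3 after the glue. CONDITIONAL on every
antecedent; nothing is booked. [cite: WZhang2014, Thm. 1.1, Thm. 7.2, §9] [cite: McCallumLMS1991, §5 Cor. 5.6] -/
theorem bottomRankOneAdditive_of_levelSystems_of_botFreeGlue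
    (hglue : PublishedInputsAdditiveKoly → PublishedDualityInputsAdditiveKoly → LevelKolyvaginSystemsAdditive →
      KolyvaginPrimitiveAdditive)
    (hPub : PublishedInputsAdditiveKoly) (hDual : PublishedDualityInputsAdditiveKoly)
    (hKS : LevelKolyvaginSystemsAdditive) : BottomRankOneAdditive :=
  bottomRankOneAdditive_of_kolyvaginPrimitiveAdditive hPub (hglue hPub hDual hKS)

end Summit.BirchSwinnertonDyer.BirchSwinnertonDyer.Theorems.AdditiveKoly

end
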